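import Summits.BirchSwinnertonDyer.BirchSwinnertonDyer.Theorems.KimAtThreeShallowEqDeepValueRowsNonAdd
import Summits.BirchSwinnertonDyer.BirchSwinnertonDyer.Theorems.KimAtThreeShallowEqDeepPortOfZetaBody
import Summits.BirchSwinnertonDyer.BirchSwinnertonDyer.Theorems.KimAtThreeShallowEqDeepPortRows
import HarnessLib

/-!
# Route `KimAtThreeKolyvagin` (W2): the UNLOCKED Kato–Kurihara port at `3` on the NON-ADDITIVE off-stratum rows
# (good non-anomalous / supersingular / multiplicative `3`, `t = 0`) FROM KATO'S EULER SYSTEM — crux 19560's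
# discharger shape with the (P-EXP) rider at exponent `1` and the non-anomalous certificate, NO `9 ∣ N`

Cell `bsd-addord`, seat `bsd-addord-w2-c4` (gen 8; owner of crux 19599 `ShallowEqDeepOffKatoStratum`, item
19077 `ShallowEqDeepAtTorsionFree`).  `--supports` 19599.  HONEST FRAMING: theorems only (no definition, no
named fact, no instance, no `sorry`); END THEOREMS WITH DISPLAYED HYPOTHESES — Kato's cited matrix `ZetaBody`
(`hbody`), R-κ (b), END-m1's level-free guards, the NON-ANOMALOUS depletion certificate and the 𝔊⁻ certificate,
n1011's (P-EXP) rider family AT EXPONENT `1`, THEOREM D's row certificates `hbad` / `ht0`; nothing asserted,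
nothing booked; 19560 / 19599 / 19077 stay OPEN; BSD is not proved by any of this.  Credit: ★ PK-6₂ is n1011's
(cell `b2b-bsdres`, seats p13 / p02 / p15 / p18); its unlocked twin is this seat's gen 7 (p475469).

## What (gen 7's NEXT (2), executed)

Gen 7 (`KimAtThreeShallowEqDeepPortOfZetaBody`, memo HOME/w2c4/W2C4-PORTSEAM-g7.md §5) showed that the
off-stratum port of W2 (PORT@3-OFF / PORT@3-ALL) has EXACTLY crux 19560's named discharger — `ZetaBody` + the
(P-EXP) riders + THEOREM D + the per-level VALUE ROWS — and that the reduction type at `3` enters ONLY the rider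
`KatoExpStarFiniteLevelAt` and the value rows' discharge T-PK6-VDIS, whose `9 ∣ N` made it additive-specific.
THIS FILE removes `9 ∣ N`: on a `t = 0` row whose reduction at `3` is good NON-anomalous, supersingular or
multiplicative with `3 ∤ c₃`, the dual-exponential lattice is `exp*_ω(H¹(ℚ₃,T)) = 3⁻¹ℤ₃` (Kim AJM 148 Lemma 3.3;
the Tate-curve lattice `3^{v₃(c₃)−t−1}ℤ₃`), uniformly in the unramified `3`-power tower, so the finite-level
functional is `Λfin = 3·exp*`, i.e. the rider holds AT EXPONENT `1`
(`KatoExpStarFiniteLevelAt W 3 j 1 v₃ Λ (Λfin j)`) — equivalently at exponent `0` for the `3`-SCALED datum `3•Λ`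
(§1 `katoExpStarFiniteLevelAt_smul`); and the value rows of the `3`-scaled zeta body
(`KimAtThreeShallowEqDeepZetaBodyScaling.zetaBody_smul`: `κ ↦ 3κ`, `Λ ↦ 3•Λ`, `x ↦ 3•x`) are discharged by
`KimAtThreeShallowEqDeepValueRowsNonAdd.valueRows_of_zetaBody_mul` from the ORIGINAL `hbody` under the
NON-ANOMALOUS depletion certificate `v₃(3·∏_{q∣3A}(1 − a_q/q + 𝟙_{q∤N}/q)) = 0` (its `q = 3` factor is
`4 − a₃ = #Ẽ(𝔽₃)` at a good `3`, `3 ∓ 1` at a multiplicative `3`).  §2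
`katoKuriharaPortUnlocked_zero_of_zetaBody_nonAdd` = gen 7's unlocked ★ PK-6₂ applied to the scaled body: the
UNLOCKED port (PORT@3-ALL's inner text at one `(W, v₃, η, P)`) from `hbody` + R-κ + guards + the two certificates
+ the exponent-`1` riders + `hcdA` + `hbad` + `ht0` + surj(3) — the SAME displayed inputs as 19560's
`…OfValueRows` discharger with TWO edits (rider exponent `0 ↦ 1`, depletion certificate `∏ ↦ 3·∏`) and NO
`9 ∣ N`.  READING for the planner (08-28): the definition item `defn-KatoKuriharaDictionaryThreeNonAddAt` is
not needed for these rows — the non-additive port is ★ PK-6₂ on the `3`-scaled zeta body, i.e. the SAME debt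
class K22-Thm3.13-PORT@3 / (C1) with the rider read at exponent `1`; only the good ANOMALOUS rows
(`a₃ ≡ 1 mod 3`, certificate fails, semi-local lattice jumps) remain outside.
HONEST LIMITS: `t = 0` only; `hbad` excludes rows with a `3`-anomalous bad place (w2-c3's D-u chain removes it
on the Kato stratum; not re-done here); good anomalous `3` not covered; nothing booked.

References: [Kato2004Asterisque] §6.2 p. 161, Thm. 6.6 (1) p. 163, §9.4, Thm. 9.7 p. 189, Ex. 13.3;
[Kim2022StructureSelmer] Lemma 3.3, Thm. 3.13, §3.3–§3.5; [MazurRubin2004] Def. 3.1.3, Thm. 3.2.4, App. A;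
[Sakamoto2024] §2, Def. 4.1; [Rubin2000] Def. 4.4.4; memo HOME/w2c4/W2C4-PORTSEAM-g7.md §5.
-/

set_option autoImplicit false
-- the Theorems namespace of a single-conjunct summit repeats the summit name by design (D-0017)
set_option linter.dupNamespace false

noncomputable section

open scoped NumberField TensorProduct ContRepresentation Classical
open CategoryTheory Field Function Finset IsDedekindDomain NumberField WeierstrassCurve
open Rat.HeightOneSpectrum
open Literature.NumberTheory.GaloisRepresentations Literature.NumberTheory.GaloisCohomology
open Literature.NumberTheory.GaloisRepresentations.DiscreteGaloisModule
open Literature.NumberTheory.EllipticCurves Literature.NumberTheory.EllipticCurves.ModularForms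
open Literature.NumberTheory.EllipticCurves.Kato2004
open Literature.NumberTheory.EllipticCurves.Kato2004.EulerSystemValues

namespace Summit.BirchSwinnertonDyer.BirchSwinnertonDyer.Theorems.KimAtThreeShallowEqDeepPortNonAdd

open Summit.BirchSwinnertonDyer.Rank1Residual.GaloisImage
open Summit.BirchSwinnertonDyer.BirchSwinnertonDyer.Theorems
open Summit.BirchSwinnertonDyer.BirchSwinnertonDyer.Theorems.KimAtThreeShallowEqDeepZetaBodyScaling
open Summit.BirchSwinnertonDyer.BirchSwinnertonDyer.Theorems.KimAtThreeShallowEqDeepValueRowsNonAdd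

/-! ### §1 The (P-EXP) rider at exponent `t + 1` for `Λ` is the rider at exponent `t` for `p • Λ` -/

/-- **Exponent shift of n1011's (P-EXP) rider**: `KatoExpStarFiniteLevelAt W p k (t+1) v Λ Λfin` (the
finite-level functional `Λfin` agrees with `p^{t+1}·Λ` modulo `p^{k+1}·L_int` on classes landing in `𝓕_can(v)`)
is EXACTLY the rider at exponent `t` for the `p`-scaled datum `p • Λ` — clause (i) does not mention `Λ`,
clause (ii) reads `p^{t+1}•Λ = p^t•(p•Λ)`.  At a good NON-anomalous / supersingular / multiplicative `p` with
`E(ℚ_p)[p] = 0` the dual-exponential lattice is `p⁻¹ℤ_p` (Kim AJM 148 Lemma 3.3 / Tate curve), so the primitive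
functional is `Λfin = p·exp*`: the rider at exponent `1` for Kato's `Λ`, hence at exponent `0` for `p•Λ`.
[cite: Kim2022StructureSelmer, Lemma 3.3 and §3.3 (arXiv v3 pp. 17–18)] -/
theorem katoExpStarFiniteLevelAt_smul {W : WeierstrassCurve ℚ} [W.IsElliptic] {p : ℕ} [Fact p.Prime]
    [ContinuousSMul ℤ_[p] (W.tateModule p)] {k t : ℕ} {v : HeightOneSpectrum (𝓞 ℚ)}
    {Λ : ∀ (k' : ℕ) (r : Finset (HeightOneSpectrum (𝓞 ℚ))),
      H1 (tateRep W p) (cycSubgroup p k' r) →ₗ[ℤ_[p]] ℚ_[p] ⊗[ℚ] CyclotomicField (cycLevel p k' r) ℚ}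
    {Λfin : galoisCohomology ((W.torsionGaloisModule ((p : ℤ) ^ k * (p : ℤ))).toLocal
      (Sum.inr v)) 1 →+ ZMod (p ^ (k + 1))}
    (h : KatoExpStarFiniteLevelAt W p k (t + 1) v Λ Λfin) :
    KatoExpStarFiniteLevelAt W p k t v (fun k' r => (p : ℤ_[p]) • Λ k' r) Λfin := by
  obtain ⟨h1, h2, h3⟩ := h
  refine ⟨h1, h2, fun r Ψ hΨ y κ₀ s hres hloc hval => h3 r Ψ hΨ y κ₀ s hres hloc ?_⟩
  obtain ⟨l, hl, heq⟩ := hval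
  refine ⟨l, hl, ?_⟩
  rw [← heq, LinearMap.smul_apply, smul_smul, ← pow_succ]

/-! ### §2 The unlocked port on the non-additive rows from `ZetaBody`, the exponent-`1` riders and the certificates -/

variable (W : WeierstrassCurve ℚ) [W.IsElliptic] [W.IsGloballyMinimal]
  [ContinuousSMul ℤ_[3] (W.tateModule 3)] [Module.Free ℤ_[3] (W.tateModule 3)]
  [Module.Finite ℤ_[3] (W.tateModule 3)]

set_option backward.isDefEq.respectTransparency false in
/-- **★ PK-6₂ UNLOCKED on the NON-ADDITIVE `t = 0` rows, value rows DISCHARGED without `9 ∣ N`** (module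
docstring): the unlocked Kato–Kurihara port at `t = 0` — n1011's one-exponent witness clauses
`KatoKuriharaWitnessAt W · 0 · v₃ P` at two depths + (COMP), for all `k ≤ k′`, shared-`η` canonical `τ`-data,
pinned `red` — from: Kato's witnesses `hbody : ZetaBody W 3 P.f ι κK Λ c d a A z x` at the conductor level
(`hN`), R-κ (b) (`hNorm`, `hκ0`), END-m1's level-free guards (`d′`, `hcd`, `hdd′`, `hAN`), integer models `aM`
of `a_q(f)`, `q ∣ 3A`, the NON-ANOMALOUS depletion certificate `hE0`/`hE` (`v₃(3·∏_{q∣3A}(…)) = 0`) and the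
𝔊⁻ certificate `hR0`/`hR`, surj(3), the place `v₃ ∣ 3`, the (P-EXP) rider family AT EXPONENT `1` (`hfin`),
the auxiliary-datum side condition `hcdA`, THEOREM D's certificates `hbad` / `ht0`.  Proof: gen 7's
`katoKuriharaPortUnlocked_zero_of_zetaBody` on the `3`-scaled body `zetaBody_smul 3 hbody`, riders by
`katoExpStarFiniteLevelAt_smul`, value rows by `valueRows_of_zetaBody_mul`.  Nothing asserted; nothing booked.
[cite: Kato2004Asterisque, §9.4 (p. 188), Thm. 9.7 (p. 189), §6.2 (p. 161), Thm. 6.6 (1) (p. 163) and Ex. 13.3 (pp. 224–225)]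
[cite: Kim2022StructureSelmer, Lemma 3.3, Thm. 3.13 and §3.3–§3.5 (arXiv v3 pp. 17–18, 26–28)]
[cite: MazurRubin2004, Def. 3.1.3, Thm. 3.2.4 and App. A (Lemma A.1)] [cite: Sakamoto2024, §2 and Def. 4.1] -/
theorem katoKuriharaPortUnlocked_zero_of_zetaBody_nonAdd
    {N : ℕ} [NeZero N] (P : ModularParametrizationData W N) (hN : N = W.conductorNorm ℤ)
    {ι : (n : ℕ) → (CyclotomicField n ℚ →+* ℂ)} {κK : ℝ}
    {Λ : ∀ (k' : ℕ) (r : Finset (HeightOneSpectrum (𝓞 ℚ))),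
      H1 (tateRep W 3) (cycSubgroup 3 k' r) →ₗ[ℤ_[3]] ℚ_[3] ⊗[ℚ] CyclotomicField (cycLevel 3 k' r) ℚ}
    {c d a : ℤ} {A : ℕ} [NeZero A]
    {z : ∀ (k' : ℕ) (r : (cyclotomicLevelsRat 3 (badPlaces c d A N)).Ideals),
      H1 (tateRep W 3) ((cyclotomicLevelsRat 3 (badPlaces c d A N)).level k' r.1)}
    {x : ∀ (k' : ℕ) (r : (cyclotomicLevelsRat 3 (badPlaces c d A N)).Ideals),
      CyclotomicField (cycLevel 3 k' r.1) ℚ}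
    (hbody : ZetaBody W 3 P.f ι κK Λ c d a A z x)
    -- R-κ (b) and END-m1's level-free guards
    (hNorm : ∃ u : ℚ, (u : ℝ) = κK ∧ padicValRat 3 u = 0) (hκ0 : κK ≠ 0)
    (d' : ℤ) (hcd : Int.gcd (c * d) A = 1) (hdd' : d * d' ≡ 1 [ZMOD (A : ℤ)]) (hAN : Nat.Coprime A N)
    (aM : ℕ → ℤ) (haM : ∀ q ∈ (3 * A).primeFactors, cuspCoeff P.f q = aM q)
    -- the NON-ANOMALOUS depletion certificate (`q = 3` factor: `4 − a₃` good / `3 ∓ 1` multiplicative)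
    (hE0 : ∏ q ∈ (3 * A).primeFactors, (1 - (aM q : ℚ) / q + (if q ∣ N then 0 else (1 / q : ℚ))) ≠ 0)
    (hE : padicValRat 3 ((3 : ℚ) *
      ∏ q ∈ (3 * A).primeFactors, (1 - (aM q : ℚ) / q + (if q ∣ N then 0 else (1 / q : ℚ)))) = 0)
    -- the 𝔊⁻ certificate
    (hR0 : (c : ℚ) ^ 2 * (d : ℚ) ^ 2 * ratMinusSymbol P.f ((a : ℚ) / A) -
        (c : ℚ) * (d : ℚ) ^ 2 * ratMinusSymbol P.f ((a * c : ℚ) / A) -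
        (c : ℚ) ^ 2 * (d : ℚ) * ratMinusSymbol P.f ((a * d' : ℚ) / A) +
        (c : ℚ) * (d : ℚ) * ratMinusSymbol P.f ((a * c * d' : ℚ) / A) ≠ 0)
    (hR : padicValRat 3 ((c : ℚ) ^ 2 * (d : ℚ) ^ 2 * ratMinusSymbol P.f ((a : ℚ) / A) -
        (c : ℚ) * (d : ℚ) ^ 2 * ratMinusSymbol P.f ((a * c : ℚ) / A) -
        (c : ℚ) ^ 2 * (d : ℚ) * ratMinusSymbol P.f ((a * d' : ℚ) / A) +
        (c : ℚ) * (d : ℚ) * ratMinusSymbol P.f ((a * c * d' : ℚ) / A)) = 0)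
    {v₃ : HeightOneSpectrum (𝓞 ℚ)} (hv₃ : ((3 : ℕ) : 𝓞 ℚ) ∈ v₃.asIdeal)
    (hsurj : W.HasSurjectiveModNGaloisRep ((3 : ℕ) : ℤ))
    -- the (P-EXP) riders AT EXPONENT `1` (lattice `3⁻¹ℤ₃`: good non-anomalous / supersingular / multiplicative `3`)
    (Λfin : ∀ j : ℕ, galoisCohomology ((W.torsionGaloisModule (((3 : ℕ) : ℤ) ^ j * ((3 : ℕ) : ℤ))).toLocal
      (Sum.inr v₃)) 1 →+ ZMod (3 ^ (j + 1)))
    (hfin : ∀ j : ℕ, KatoExpStarFiniteLevelAt W 3 j 1 v₃ Λ (Λfin j))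
    {η : (q : HeightOneSpectrum (𝓞 ℚ)) → (ZMod (Ideal.absNorm q.asIdeal))ˣ}
    (hcdA : ∀ q : ℕ, q.Prime → q ≡ 1 [MOD 3] → ¬ q ∣ 2 * c.natAbs * d.natAbs * A)
    -- THEOREM D's row certificates
    (hbad : ∀ w : HeightOneSpectrum (𝓞 ℚ), ¬ W.HasGoodReductionAt w →
      ((primesEquiv w : Nat.Primes) : ℕ) ≠ 3 →
        ∀ Q : (W.baseChange (w.adicCompletion ℚ)).toAffine.Point, 3 • Q = 0 → Q = 0)
    (ht0 : ∀ w : HeightOneSpectrum (𝓞 ℚ), ((3 : ℕ) : 𝓞 ℚ) ∈ w.asIdeal →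
        ∀ Q : (W.baseChange (w.adicCompletion ℚ)).toAffine.Point, 3 • Q = 0 → Q = 0) :
    ∀ (k k' : ℕ) (D : KolyvaginDatum (W.torsionGaloisModule (((3 : ℕ) : ℤ) ^ k * ((3 : ℕ) : ℤ))))
      (D' : KolyvaginDatum (W.torsionGaloisModule (((3 : ℕ) : ℤ) ^ k' * ((3 : ℕ) : ℤ))))
      (red : (W.torsionGaloisModule (((3 : ℕ) : ℤ) ^ k' * ((3 : ℕ) : ℤ))).toContRepresentation →ⁱL
        (W.torsionGaloisModule (((3 : ℕ) : ℤ) ^ k * ((3 : ℕ) : ℤ))).toContRepresentation),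
      D.IsCanonicalTauDatumThreeAtWith W k k η → D'.IsCanonicalTauDatumThreeAtWith W k' k' η → k ≤ k' →
      (∀ y : geomTorsion W (((3 : ℕ) : ℤ) ^ k' * ((3 : ℕ) : ℤ)),
        ((red y : geomTorsion W (((3 : ℕ) : ℤ) ^ k * ((3 : ℕ) : ℤ))) : geomPoints W) =
          (((3 : ℕ) : ℤ) ^ (k' - k)) • (y : geomPoints W)) →
      ∃ κ Λ₀ κ' κu Λu κu',
        KatoKuriharaWitnessAt W k 0 D v₃ P κ Λ₀ κ' ∧ KatoKuriharaWitnessAt W k' 0 D' v₃ P κu Λu κu' ∧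
        ∀ e, D'.IsLevel e → D.IsLevel e →
          galoisCohomology.map red 1 (κu e) = κ e ∧ galoisCohomology.map red 1 (κu' e) = κ' e :=
  KimAtThreeShallowEqDeepPortOfZetaBody.katoKuriharaPortUnlocked_zero_of_zetaBody W P hN
    (zetaBody_smul 3 hbody) hv₃ hsurj Λfin (fun j => katoExpStarFiniteLevelAt_smul (hfin j)) hcdA hbad ht0
    (valueRows_of_zetaBody_mul hbody P.isNewformOf (by decide)
      (hasIrreducibleModPGaloisRep_of_hasSurjectiveModNGaloisRep W 3 hsurj) hNorm hκ0 d' hcd hdd' hAN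
      aM haM hE0 hE hR0 hR η)

/-! ### §3 The row conclusions of W2 on the non-additive rows: SHALLOW = DEEP (19599 / 19077) and the LEAF row -/

/-- **The unlocked port on the non-additive rows in `KimAtThreeShallowEqDeepPortRows`' currency** (acc6 / gen 7's
two-exponent witness clauses at `(t, e) = (0, 0)`): §2 composed with
`KimAtThreeKolyvaginDefs.katoKuriharaWitnessAtTwoExp_zero_of_witnessAt`.  Displayed inputs as in §2.
[cite: Kim2022StructureSelmer, Thm. 3.13 (arXiv v3 p. 17)] [cite: Kato2004Asterisque, Thm. 9.7 (p. 189)] -/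
theorem portTwoExp_zero_of_zetaBody_nonAdd
    {N : ℕ} [NeZero N] (P : ModularParametrizationData W N) (hN : N = W.conductorNorm ℤ)
    {ι : (n : ℕ) → (CyclotomicField n ℚ →+* ℂ)} {κK : ℝ}
    {Λ : ∀ (k' : ℕ) (r : Finset (HeightOneSpectrum (𝓞 ℚ))),
      H1 (tateRep W 3) (cycSubgroup 3 k' r) →ₗ[ℤ_[3]] ℚ_[3] ⊗[ℚ] CyclotomicField (cycLevel 3 k' r) ℚ}
    {c d a : ℤ} {A : ℕ} [NeZero A]
    {z : ∀ (k' : ℕ) (r : (cyclotomicLevelsRat 3 (badPlaces c d A N)).Ideals),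
      H1 (tateRep W 3) ((cyclotomicLevelsRat 3 (badPlaces c d A N)).level k' r.1)}
    {x : ∀ (k' : ℕ) (r : (cyclotomicLevelsRat 3 (badPlaces c d A N)).Ideals),
      CyclotomicField (cycLevel 3 k' r.1) ℚ}
    (hbody : ZetaBody W 3 P.f ι κK Λ c d a A z x)
    (hNorm : ∃ u : ℚ, (u : ℝ) = κK ∧ padicValRat 3 u = 0) (hκ0 : κK ≠ 0)
    (d' : ℤ) (hcd : Int.gcd (c * d) A = 1) (hdd' : d * d' ≡ 1 [ZMOD (A : ℤ)]) (hAN : Nat.Coprime A N)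
    (aM : ℕ → ℤ) (haM : ∀ q ∈ (3 * A).primeFactors, cuspCoeff P.f q = aM q)
    (hE0 : ∏ q ∈ (3 * A).primeFactors, (1 - (aM q : ℚ) / q + (if q ∣ N then 0 else (1 / q : ℚ))) ≠ 0)
    (hE : padicValRat 3 ((3 : ℚ) *
      ∏ q ∈ (3 * A).primeFactors, (1 - (aM q : ℚ) / q + (if q ∣ N then 0 else (1 / q : ℚ)))) = 0)
    (hR0 : (c : ℚ) ^ 2 * (d : ℚ) ^ 2 * ratMinusSymbol P.f ((a : ℚ) / A) -
        (c : ℚ) * (d : ℚ) ^ 2 * ratMinusSymbol P.f ((a * c : ℚ) / A) -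
        (c : ℚ) ^ 2 * (d : ℚ) * ratMinusSymbol P.f ((a * d' : ℚ) / A) +
        (c : ℚ) * (d : ℚ) * ratMinusSymbol P.f ((a * c * d' : ℚ) / A) ≠ 0)
    (hR : padicValRat 3 ((c : ℚ) ^ 2 * (d : ℚ) ^ 2 * ratMinusSymbol P.f ((a : ℚ) / A) -
        (c : ℚ) * (d : ℚ) ^ 2 * ratMinusSymbol P.f ((a * c : ℚ) / A) -
        (c : ℚ) ^ 2 * (d : ℚ) * ratMinusSymbol P.f ((a * d' : ℚ) / A) +
        (c : ℚ) * (d : ℚ) * ratMinusSymbol P.f ((a * c * d' : ℚ) / A)) = 0)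
    {v₃ : HeightOneSpectrum (𝓞 ℚ)} (hv₃ : ((3 : ℕ) : 𝓞 ℚ) ∈ v₃.asIdeal)
    (hsurj : W.HasSurjectiveModNGaloisRep ((3 : ℕ) : ℤ))
    (Λfin : ∀ j : ℕ, galoisCohomology ((W.torsionGaloisModule (((3 : ℕ) : ℤ) ^ j * ((3 : ℕ) : ℤ))).toLocal
      (Sum.inr v₃)) 1 →+ ZMod (3 ^ (j + 1)))
    (hfin : ∀ j : ℕ, KatoExpStarFiniteLevelAt W 3 j 1 v₃ Λ (Λfin j))
    {η : (q : HeightOneSpectrum (𝓞 ℚ)) → (ZMod (Ideal.absNorm q.asIdeal))ˣ}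
    (hcdA : ∀ q : ℕ, q.Prime → q ≡ 1 [MOD 3] → ¬ q ∣ 2 * c.natAbs * d.natAbs * A)
    (hbad : ∀ w : HeightOneSpectrum (𝓞 ℚ), ¬ W.HasGoodReductionAt w →
      ((primesEquiv w : Nat.Primes) : ℕ) ≠ 3 →
        ∀ Q : (W.baseChange (w.adicCompletion ℚ)).toAffine.Point, 3 • Q = 0 → Q = 0)
    (ht0 : ∀ w : HeightOneSpectrum (𝓞 ℚ), ((3 : ℕ) : 𝓞 ℚ) ∈ w.asIdeal →
        ∀ Q : (W.baseChange (w.adicCompletion ℚ)).toAffine.Point, 3 • Q = 0 → Q = 0) :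
    ∀ (k k' : ℕ) (Dk : KolyvaginDatum (W.torsionGaloisModule (((3 : ℕ) : ℤ) ^ k * ((3 : ℕ) : ℤ))))
      (Dk' : KolyvaginDatum (W.torsionGaloisModule (((3 : ℕ) : ℤ) ^ k' * ((3 : ℕ) : ℤ))))
      (red : (W.torsionGaloisModule (((3 : ℕ) : ℤ) ^ k' * ((3 : ℕ) : ℤ))).toContRepresentation →ⁱL
        (W.torsionGaloisModule (((3 : ℕ) : ℤ) ^ k * ((3 : ℕ) : ℤ))).toContRepresentation),
      Dk.IsCanonicalTauDatumThreeAtWith W k k η → Dk'.IsCanonicalTauDatumThreeAtWith W k' k' η → k ≤ k' →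
      (∀ y : geomTorsion W (((3 : ℕ) : ℤ) ^ k' * ((3 : ℕ) : ℤ)),
        ((red y : geomTorsion W (((3 : ℕ) : ℤ) ^ k * ((3 : ℕ) : ℤ))) : geomPoints W) =
          (((3 : ℕ) : ℤ) ^ (k' - k)) • (y : geomPoints W)) →
      ∃ κ Λ₀ κ' κu Λu κu',
        KimAtThreeKolyvaginDefs.KatoKuriharaWitnessAtTwoExp W k 0 0 Dk v₃ P κ Λ₀ κ' ∧
        KimAtThreeKolyvaginDefs.KatoKuriharaWitnessAtTwoExp W k' 0 0 Dk' v₃ P κu Λu κu' ∧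
        ∀ e, Dk'.IsLevel e → Dk.IsLevel e →
          galoisCohomology.map red 1 (κu e) = κ e ∧ galoisCohomology.map red 1 (κu' e) = κ' e := by
  intro k k' Dk Dk' red hDk hDk' hk hred
  obtain ⟨κ, Λ₀, κ', κu, Λu, κu', hW, hW', hcomp⟩ :=
    katoKuriharaPortUnlocked_zero_of_zetaBody_nonAdd W P hN hbody hNorm hκ0 d' hcd hdd' hAN aM haM hE0 hE
      hR0 hR hv₃ hsurj Λfin hfin hcdA hbad ht0 k k' Dk Dk' red hDk hDk' hk hred
  exact ⟨κ, Λ₀, κ', κu, Λu, κu', KimAtThreeKolyvaginDefs.katoKuriharaWitnessAtTwoExp_zero_of_witnessAt hW,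
    KimAtThreeKolyvaginDefs.katoKuriharaWitnessAtTwoExp_zero_of_witnessAt hW', hcomp⟩

/-- **SHALLOW = DEEP (the conclusion of cruxes 19599 / 19077) AT a NON-ADDITIVE `t = 0` TOWER ROW with the
datum at the conductor, FROM PUB + KATO'S EULER SYSTEM**: `∂^{(∞)}_deep(δ̃) ≤ ∂^{(∞)}(δ̃)` for the newform of a
parametrisation datum `D` of `W` at `N = N_W`, from the four PUBLISHED leaves' first two ([S24] Thm 4.4 (1)(2),
GZK, Poitou–Tate), the `3`-adic tower, `3`-integral plus symbols, `ord(δ̃) = 0`, a place `v₃ ∣ 3`, one generator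
family `η`, AND §2's displayed discharger at `(W, v₃, η, D)`: Kato's `ZetaBody` for `D.f` + R-κ + guards + the
NON-ANOMALOUS depletion certificate + the 𝔊⁻ certificate + the exponent-`1` riders + `hcdA` + THEOREM D
`hbad` / `ht0`.  Gen 7's `KimAtThreeShallowEqDeepPortRows.shallowEqDeep_row_of_portUnlocked` on §3's port.
No `Addv`, no `3 ∤ c₃`, no `9 ∣ N`, no Manin constant, no period transfer.  Nothing booked.
[cite: Kim2025RefinedTNC, Thm 1.2] [cite: Kim2022StructureSelmer, Thm. 1.9 (6), Lemma 3.3, Thm. 3.13]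
[cite: Sakamoto2024, Thm. 4.4 (p. 926)] [cite: MazurRubin2004, Thm. 5.2.12] [cite: Kato2004Asterisque, Thm. 9.7 (p. 189)] -/
theorem shallowEqDeep_row_of_zetaBody_nonAdd
    (hS24 : Sakamoto2024.kolyvaginSystems_freeRankOne_zmod_three_pow)
    (hS24₂ : Sakamoto2024.kolyvaginSystems_idealOfBasis_eq_fittingIdeal_zmod_three_pow)
    (hGZK : rank_eq_analyticRank_of_analyticRank_le_one) (hPT : poitouTate_selmerStructure_duality ℚ)
    (htower : ∀ m : ℕ, W.HasSurjectiveModNGaloisRep (3 ^ m : ℕ))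
    {N : ℕ} [NeZero N] (D : ModularParametrizationData W N) (hN : N = W.conductorNorm ℤ)
    (hint : ∀ r : ℚ, ratPlusSymbol D.f r ≠ 0 → 0 ≤ padicValRat 3 (ratPlusSymbol D.f r))
    (hord : kuriharaVanishingOrder W 3 D.f = 0)
    (v₃ : HeightOneSpectrum (𝓞 ℚ)) (hv₃ : ((3 : ℕ) : 𝓞 ℚ) ∈ v₃.asIdeal)
    (η : (q : HeightOneSpectrum (𝓞 ℚ)) → (ZMod (Ideal.absNorm q.asIdeal))ˣ)
    (hη : ∀ q : HeightOneSpectrum (𝓞 ℚ), Subgroup.zpowers (η q) = ⊤)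
    {ι : (n : ℕ) → (CyclotomicField n ℚ →+* ℂ)} {κK : ℝ}
    {Λ : ∀ (k' : ℕ) (r : Finset (HeightOneSpectrum (𝓞 ℚ))),
      H1 (tateRep W 3) (cycSubgroup 3 k' r) →ₗ[ℤ_[3]] ℚ_[3] ⊗[ℚ] CyclotomicField (cycLevel 3 k' r) ℚ}
    {c d a : ℤ} {A : ℕ} [NeZero A]
    {z : ∀ (k' : ℕ) (r : (cyclotomicLevelsRat 3 (badPlaces c d A N)).Ideals),
      H1 (tateRep W 3) ((cyclotomicLevelsRat 3 (badPlaces c d A N)).level k' r.1)}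
    {x : ∀ (k' : ℕ) (r : (cyclotomicLevelsRat 3 (badPlaces c d A N)).Ideals),
      CyclotomicField (cycLevel 3 k' r.1) ℚ}
    (hbody : ZetaBody W 3 D.f ι κK Λ c d a A z x)
    (hNorm : ∃ u : ℚ, (u : ℝ) = κK ∧ padicValRat 3 u = 0) (hκ0 : κK ≠ 0)
    (d' : ℤ) (hcd : Int.gcd (c * d) A = 1) (hdd' : d * d' ≡ 1 [ZMOD (A : ℤ)]) (hAN : Nat.Coprime A N)
    (aM : ℕ → ℤ) (haM : ∀ q ∈ (3 * A).primeFactors, cuspCoeff D.f q = aM q)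
    (hE0 : ∏ q ∈ (3 * A).primeFactors, (1 - (aM q : ℚ) / q + (if q ∣ N then 0 else (1 / q : ℚ))) ≠ 0)
    (hE : padicValRat 3 ((3 : ℚ) *
      ∏ q ∈ (3 * A).primeFactors, (1 - (aM q : ℚ) / q + (if q ∣ N then 0 else (1 / q : ℚ)))) = 0)
    (hR0 : (c : ℚ) ^ 2 * (d : ℚ) ^ 2 * ratMinusSymbol D.f ((a : ℚ) / A) -
        (c : ℚ) * (d : ℚ) ^ 2 * ratMinusSymbol D.f ((a * c : ℚ) / A) -
        (c : ℚ) ^ 2 * (d : ℚ) * ratMinusSymbol D.f ((a * d' : ℚ) / A) +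
        (c : ℚ) * (d : ℚ) * ratMinusSymbol D.f ((a * c * d' : ℚ) / A) ≠ 0)
    (hR : padicValRat 3 ((c : ℚ) ^ 2 * (d : ℚ) ^ 2 * ratMinusSymbol D.f ((a : ℚ) / A) -
        (c : ℚ) * (d : ℚ) ^ 2 * ratMinusSymbol D.f ((a * c : ℚ) / A) -
        (c : ℚ) ^ 2 * (d : ℚ) * ratMinusSymbol D.f ((a * d' : ℚ) / A) +
        (c : ℚ) * (d : ℚ) * ratMinusSymbol D.f ((a * c * d' : ℚ) / A)) = 0)
    (Λfin : ∀ j : ℕ, galoisCohomology ((W.torsionGaloisModule (((3 : ℕ) : ℤ) ^ j * ((3 : ℕ) : ℤ))).toLocal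
      (Sum.inr v₃)) 1 →+ ZMod (3 ^ (j + 1)))
    (hfin : ∀ j : ℕ, KatoExpStarFiniteLevelAt W 3 j 1 v₃ Λ (Λfin j))
    (hcdA : ∀ q : ℕ, q.Prime → q ≡ 1 [MOD 3] → ¬ q ∣ 2 * c.natAbs * d.natAbs * A)
    (hbad : ∀ w : HeightOneSpectrum (𝓞 ℚ), ¬ W.HasGoodReductionAt w →
      ((primesEquiv w : Nat.Primes) : ℕ) ≠ 3 →
        ∀ Q : (W.baseChange (w.adicCompletion ℚ)).toAffine.Point, 3 • Q = 0 → Q = 0)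
    (ht0 : ∀ w : HeightOneSpectrum (𝓞 ℚ), ((3 : ℕ) : 𝓞 ℚ) ∈ w.asIdeal →
        ∀ Q : (W.baseChange (w.adicCompletion ℚ)).toAffine.Point, 3 • Q = 0 → Q = 0) :
    kuriharaPartialDeepInfty W 3 D.f ≤ kuriharaPartialInfty W 3 D.f :=
  KimAtThreeShallowEqDeepPortRows.shallowEqDeep_row_of_portUnlocked hS24 hS24₂ hGZK hPT W htower D 0 hint hord
    v₃ hv₃ η hη
    (portTwoExp_zero_of_zetaBody_nonAdd W D hN hbody hNorm hκ0 d' hcd hdd' hAN aM haM hE0 hE hR0 hR hv₃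
      (by simpa using htower 1) Λfin hfin hcdA hbad ht0) hN

/-- **The LEAF row (`N11.KimAtThreeRankZeroPUB` at the row = Kim's clause (6) at `p = 3`): `∃ d, ∂^{(∞)} = d ∧
∂⁽⁰⁾ = ord₃ #Ш(3) + d` AT a NON-ADDITIVE `t = 0` TOWER ROW with the datum at the conductor, FROM PUB + KATO'S
EULER SYSTEM** — same displayed inputs as `shallowEqDeep_row_of_zetaBody_nonAdd`; gen 7's
`KimAtThreeShallowEqDeepPortRows.leaf_row_of_portUnlocked` on §3's port.  Nothing booked; BSD is not proved by this.
[cite: Kim2025RefinedTNC, Thm 1.1] [cite: Kim2022StructureSelmer, Thm. 1.9 (6)]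
[cite: Sakamoto2024, Thm. 4.4 (p. 926)] [cite: MazurRubin2004, Thm. 4.4.1 and Thm. 5.2.12] -/
theorem leaf_row_of_zetaBody_nonAdd
    (hS24 : Sakamoto2024.kolyvaginSystems_freeRankOne_zmod_three_pow)
    (hS24₂ : Sakamoto2024.kolyvaginSystems_idealOfBasis_eq_fittingIdeal_zmod_three_pow)
    (hGZK : rank_eq_analyticRank_of_analyticRank_le_one) (hPT : poitouTate_selmerStructure_duality ℚ)
    (htower : ∀ m : ℕ, W.HasSurjectiveModNGaloisRep (3 ^ m : ℕ))
    {N : ℕ} [NeZero N] (D : ModularParametrizationData W N) (hN : N = W.conductorNorm ℤ)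
    (hint : ∀ r : ℚ, ratPlusSymbol D.f r ≠ 0 → 0 ≤ padicValRat 3 (ratPlusSymbol D.f r))
    (hord : kuriharaVanishingOrder W 3 D.f = 0)
    (v₃ : HeightOneSpectrum (𝓞 ℚ)) (hv₃ : ((3 : ℕ) : 𝓞 ℚ) ∈ v₃.asIdeal)
    (η : (q : HeightOneSpectrum (𝓞 ℚ)) → (ZMod (Ideal.absNorm q.asIdeal))ˣ)
    (hη : ∀ q : HeightOneSpectrum (𝓞 ℚ), Subgroup.zpowers (η q) = ⊤)
    {ι : (n : ℕ) → (CyclotomicField n ℚ →+* ℂ)} {κK : ℝ}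
    {Λ : ∀ (k' : ℕ) (r : Finset (HeightOneSpectrum (𝓞 ℚ))),
      H1 (tateRep W 3) (cycSubgroup 3 k' r) →ₗ[ℤ_[3]] ℚ_[3] ⊗[ℚ] CyclotomicField (cycLevel 3 k' r) ℚ}
    {c d a : ℤ} {A : ℕ} [NeZero A]
    {z : ∀ (k' : ℕ) (r : (cyclotomicLevelsRat 3 (badPlaces c d A N)).Ideals),
      H1 (tateRep W 3) ((cyclotomicLevelsRat 3 (badPlaces c d A N)).level k' r.1)}
    {x : ∀ (k' : ℕ) (r : (cyclotomicLevelsRat 3 (badPlaces c d A N)).Ideals),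
      CyclotomicField (cycLevel 3 k' r.1) ℚ}
    (hbody : ZetaBody W 3 D.f ι κK Λ c d a A z x)
    (hNorm : ∃ u : ℚ, (u : ℝ) = κK ∧ padicValRat 3 u = 0) (hκ0 : κK ≠ 0)
    (d' : ℤ) (hcd : Int.gcd (c * d) A = 1) (hdd' : d * d' ≡ 1 [ZMOD (A : ℤ)]) (hAN : Nat.Coprime A N)
    (aM : ℕ → ℤ) (haM : ∀ q ∈ (3 * A).primeFactors, cuspCoeff D.f q = aM q)
    (hE0 : ∏ q ∈ (3 * A).primeFactors, (1 - (aM q : ℚ) / q + (if q ∣ N then 0 else (1 / q : ℚ))) ≠ 0)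
    (hE : padicValRat 3 ((3 : ℚ) *
      ∏ q ∈ (3 * A).primeFactors, (1 - (aM q : ℚ) / q + (if q ∣ N then 0 else (1 / q : ℚ)))) = 0)
    (hR0 : (c : ℚ) ^ 2 * (d : ℚ) ^ 2 * ratMinusSymbol D.f ((a : ℚ) / A) -
        (c : ℚ) * (d : ℚ) ^ 2 * ratMinusSymbol D.f ((a * c : ℚ) / A) -
        (c : ℚ) ^ 2 * (d : ℚ) * ratMinusSymbol D.f ((a * d' : ℚ) / A) +
        (c : ℚ) * (d : ℚ) * ratMinusSymbol D.f ((a * c * d' : ℚ) / A) ≠ 0)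
    (hR : padicValRat 3 ((c : ℚ) ^ 2 * (d : ℚ) ^ 2 * ratMinusSymbol D.f ((a : ℚ) / A) -
        (c : ℚ) * (d : ℚ) ^ 2 * ratMinusSymbol D.f ((a * c : ℚ) / A) -
        (c : ℚ) ^ 2 * (d : ℚ) * ratMinusSymbol D.f ((a * d' : ℚ) / A) +
        (c : ℚ) * (d : ℚ) * ratMinusSymbol D.f ((a * c * d' : ℚ) / A)) = 0)
    (Λfin : ∀ j : ℕ, galoisCohomology ((W.torsionGaloisModule (((3 : ℕ) : ℤ) ^ j * ((3 : ℕ) : ℤ))).toLocal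
      (Sum.inr v₃)) 1 →+ ZMod (3 ^ (j + 1)))
    (hfin : ∀ j : ℕ, KatoExpStarFiniteLevelAt W 3 j 1 v₃ Λ (Λfin j))
    (hcdA : ∀ q : ℕ, q.Prime → q ≡ 1 [MOD 3] → ¬ q ∣ 2 * c.natAbs * d.natAbs * A)
    (hbad : ∀ w : HeightOneSpectrum (𝓞 ℚ), ¬ W.HasGoodReductionAt w →
      ((primesEquiv w : Nat.Primes) : ℕ) ≠ 3 →
        ∀ Q : (W.baseChange (w.adicCompletion ℚ)).toAffine.Point, 3 • Q = 0 → Q = 0)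
    (ht0 : ∀ w : HeightOneSpectrum (𝓞 ℚ), ((3 : ℕ) : 𝓞 ℚ) ∈ w.asIdeal →
        ∀ Q : (W.baseChange (w.adicCompletion ℚ)).toAffine.Point, 3 • Q = 0 → Q = 0) :
    ∃ dd : ℕ, kuriharaPartialInfty W 3 D.f = dd ∧
      kuriharaPartial W 3 D.f 0 =
        ((padicValNat 3 (Nat.card (AddCommGroup.primaryComponent W.sha 3)) + dd : ℕ) : ℕ∞) :=
  KimAtThreeShallowEqDeepPortRows.leaf_row_of_portUnlocked hS24 hS24₂ hGZK hPT W htower D 0 hint hord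
    v₃ hv₃ η hη
    (portTwoExp_zero_of_zetaBody_nonAdd W D hN hbody hNorm hκ0 d' hcd hdd' hAN aM haM hE0 hE hR0 hR hv₃
      (by simpa using htower 1) Λfin hfin hcdA hbad ht0) hN

end Summit.BirchSwinnertonDyer.BirchSwinnertonDyer.Theorems.KimAtThreeShallowEqDeepPortNonAdd

end
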